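import Summits.ResolutionOfSingularities.ResolutionOfSingularities.Theorems.EquisingularLiftEquisingularLiftNatHostedSubchainPointResolution2
import Summits.ResolutionOfSingularities.ResolutionOfSingularities.Theorems.EquisingularLiftEquisingularLiftNatHostedRoundSeam
import Summits.ResolutionOfSingularities.ResolutionOfSingularities.Theorems.EquisingularLiftEquisingularLiftNatHostedPointStepSeam
import Summits.ResolutionOfSingularities.ResolutionOfSingularities.Theorems.EquisingularLiftEquisingularLiftNatHostedEngineInit
import Summits.ResolutionOfSingularities.ResolutionOfSingularities.Theorems.EquisingularLiftEquisingularLiftNatNoseHostedHSUB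
import Summits.ResolutionOfSingularities.ResolutionOfSingularities.Theorems.EquisingularLiftEquisingularLiftNatResidueHypDefs7
import Summits.ResolutionOfSingularities.ResolutionOfSingularities.Theorems.EquisingularLiftEquisingularLiftNatResidueHypDefs
import HarnessLib

/-!
# [OURS · L1 W4.5(b) · EL♮(3) · WIDTH TABLE D4 «HOSTED NOSE», THE RUNG (R-ν3)] SURFACES WITH A HOSTED-NEST NOSE RESOLUTION LIFT
# `stub_elnat_hostedNestNoseBTriplePrimeResolutionThree : (T-k) → … → NoseHypHostedNestBTriplePrime₂ k 3 H ι → ELNatConclusionO k 3 H ι`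

res-L1-w45b-stub-2 g15 (desk `WIDTH TABLE D4`, R43 (4) / R44 (4) order «Defs7 ✓ ∥ engine v2.2 ✓ → hround_seam ✓ → HSUBʰ ✓ → RUNG (R-ν3) → 39th texts»).
OURS; NOT a statement of any manuscript ([Hironaka2017] is a candidate under adjudication, nothing of it is asserted); AI-written, weaker than expert
review.  No `sorry`; standard axioms; DEF-FREE; the residue (T-k) `EmbeddedCurveLiftFact` is a HYPOTHESIS (registered stub of the skeleton of record), so
the rung is CONDITIONAL on it exactly as (R-ν1) ✓ `stub_elnat_unobsNoseTowerBTriplePrimeResolutionThree` was.  `--supports stmt-ResolutionOfSingularities-20148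
--as helper`.  EL♮(3) is NOT proved here: the rung moves the surfaces of res-type-027's ν2ʰ⁺ᴺ v2.2 (`NoseHypHostedNestBTriplePrime₂`, ✓ `…NatResidueHypDefs7`)
— downstairs resolutions by hosted point steps, stage-level hosted CURVE rounds and hosted-nose/B‴-tail reach moves, from the host `∅` or a hyperplane
`V₊(ℓ) ⊅ H` — out of the non-isolated residue; the 39th registration's residue stub is `¬ NoseHypHostedNestBTriplePrime₂`.

PROOF = ONE application of this seat's K5ʰ v2.2 engine ✓ `target_elnat_of_hostedSubchainResolution₂` at `n := 3`,
`ReachH := ReachHostedNoseBTriplePrime`, with the four suppliers BY NAME: HINIT = ✓ `hinit_empty` / ✓ `hinit_hyperplane` (this seat, by cases on `E₀`),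
HPT = res-L1-w45b-stub-4's ✓ `TCPlus.hpt_seam k 3`, HROUND₂ = this seat's ✓ `TCPlus.hround_seam k hF`, HSUBʰ = res-L1-w45b-nose-w2's ✓
`hsubh_reachHostedNoseBTriplePrime_of_embeddedCurveLiftFact hF k`; `hres` = the blob unpacked. [folklore; pure composition]
-/

set_option linter.dupNamespace false -- mandated namespace `Summit.<Summit>.<Problem>` of this single-conjunct summit

noncomputable section

open CategoryTheory CategoryTheory.Limits AlgebraicGeometry TopologicalSpace Topology
open Literature.AlgebraicGeometry.Resolution
open AlgebraicGeometry.Scheme.IdealSheafData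
open Summit.ResolutionOfSingularities.ResolutionOfSingularities.Theses.EquisingularLift.Split
open Summit.ResolutionOfSingularities.ResolutionOfSingularities.Cruxes.EquisingularLift.StrataSplit

namespace Summit.ResolutionOfSingularities.ResolutionOfSingularities.Cruxes.EquisingularLiftNat.Sections

/-- **THE RUNG (R-ν3): surfaces `H ⊂ ℙ³_k` with a HOSTED-NEST nose resolution downstairs (ν2ʰ⁺ᴺ v2.2) satisfy EL♮(3)'s conclusion, given (T-k).**
One application of the K5ʰ v2.2 engine with its four suppliers by name (see the module docstring). [folklore; pure composition]
[OURS · L1 W4.5b · WIDTH TABLE D4 · rung (R-ν3)] -/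
theorem stub_elnat_hostedNestNoseBTriplePrimeResolutionThree (p : ℕ) : EmbeddedCurveLiftFact → p.Prime →
    ∀ (k : Type) [Field k] [CharP k p] [IsAlgClosed k] (H : AlgebraicGeometry.Scheme.{0})
    (ι : H ⟶ (Literature.AlgebraicGeometry.Motives.projectiveSpace 3 k).left),
    AlgebraicGeometry.IsClosedImmersion ι → AlgebraicGeometry.IsIntegral H →
    (∀ y : (Literature.AlgebraicGeometry.Motives.projectiveSpace 3 k).left,
      ∃ U : (Literature.AlgebraicGeometry.Motives.projectiveSpace 3 k).left.affineOpens,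
        y ∈ (U : (Literature.AlgebraicGeometry.Motives.projectiveSpace 3 k).left.Opens) ∧ (ι.ker.ideal U).IsPrincipal) →
    NoseHypHostedNestBTriplePrime₂ k 3 H ι → ELNatConclusionO k 3 H ι := by
  intro hF hp k _ _ _ H ι hι hH hloc hν
  haveI := hι; haveI := hH
  obtain ⟨E₀, hE₀, hres⟩ := hν
  rcases hE₀ with rfl | ⟨ℓ, hℓ1, hℓ0, hHℓ, rfl⟩
  · exact target_elnat_of_hostedSubchainResolution₂ p hp k 3 H ι hι hH hloc ∅ ReachHostedNoseBTriplePrime (hinit_empty k 3 H ι)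
      (TCPlus.hpt_seam k 3) (TCPlus.hround_seam k hF) (hsubh_reachHostedNoseBTriplePrime_of_embeddedCurveLiftFact hF k) hres
  · exact target_elnat_of_hostedSubchainResolution₂ p hp k 3 H ι hι hH hloc _ ReachHostedNoseBTriplePrime
      (hinit_hyperplane k 2 H ι ℓ hℓ1 hℓ0 hHℓ) (TCPlus.hpt_seam k 3) (TCPlus.hround_seam k hF)
      (hsubh_reachHostedNoseBTriplePrime_of_embeddedCurveLiftFact hF k) hres

end Summit.ResolutionOfSingularities.ResolutionOfSingularities.Cruxes.EquisingularLiftNat.Sections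

end
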